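import Summits.QuantumFields.YangMills.Theorems.BalabanUVNodesN22W1RelCentredNumerals
import Summits.QuantumFields.YangMills.Theorems.BalabanUVNodesN18HLayerW1NumeralsStrict

/-!
# BalabanUVNodes ∕ node N22 = NE9 — THE RELATIVE-DISC CENTRED ROAD, MODULE R4s: THE LEAF NUMERALS WITH THE STRICT [KP86] CLAUSE ARE JOINTLY SATISFIABLE
# (the A-column «numerals jointly satisfiable» for the ADMISSIBLE-HISTORY ∕ LOCAL-GROWTH storeys R2ᴬ ∕ J2ᴬ ∕ J10c, whose smallness clause is `… < 1`)

Cell `pub-ymgap`, HUMAN RULING D-0062 (Track A), R134 ACCELERATION re-seat `pub-ymgap-dag-n22-c` (strategy s1), generation 8, file R4s.  THEOREMS ONLY; imports R4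
`…N22W1RelCentredNumerals` (v1.0–v1.2: the conjunctions with the NON-strict clause `≤ 1`) and dag-n18-c's `…N18HLayerW1NumeralsStrict` (`Summit.QuantumFields.YangMills.BalabanUVNodes.N18HLayerW1NumeralsStrict.smallKP_consts_strict`:
`consts.C3act·consts.ε₁·e^{5κ+1}·K₀(64,8)·9·64 < 1` at the numerics record of record, BY NAME).  `--supports` K3⁷ `SpineGivenEndpointR13SepCoPH` (stmt-QuantumFields-20544) as a helper.

WHY.  The ᴬ engines (R2ᴬ `…TermDatum214Adm`, J2ᴬ `…TermDatum214WindowDilatedAdm`, J10c `…DatumKnitLG`) inherit N18's recursion interface and therefore display the STRICT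
[KP86] clause `c.C3act * c.ε₁ * Real.exp (5 * r₁ + 1) * K₀ 64 8 * 9 * 64 < 1`; R4 v1.1 ∕ v1.2 witness the leaf numerals with `≤ 1` only.  THIS FILE: R4 §2 and §3 VERBATIM with the
strict clause, the witness unchanged (`c := consts`, `r₁ := consts.κ`) except that the clause is read from `smallKP_consts_strict`.

HONEST FRAMING.  Count-neutral arithmetic (A-column bookkeeping); asserts nothing of Bałaban's; N22 NOT discharged; one finite four-torus programme at fixed ε — NOT infinite volume,
NOT OS on ℝ⁴, NOT a mass gap, NOT Clay.  0 `sorry`, 0 `def`, standard axioms.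

References (TYPES only): [II] = [Balaban1988RG2Cluster] (2.15) p. 15, (2.24)–(2.26) p. 17, Lemma 3 p. 20, (2.39)–(2.41) p. 21; [I] = [Balaban1987RG1] §1 p. 263, (2.9)–(2.10) pp. 266–267;
[KP86] as cited in R4.
-/

noncomputable section

namespace YMDAG.N22.W1

open Set Metric
open scoped BigOperators
open Literature.MathematicalPhysics.QuantumFieldTheory.Balaban1983to89
open Literature.MathematicalPhysics.QuantumFieldTheory.Balaban1983to89.TreeLengthTorus (TDom)
open Literature.MathematicalPhysics.QuantumFieldTheory.Balaban1983to89.B12TreeDecay (K₀ K₀_pos)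
open Literature.MathematicalPhysics.QuantumFieldTheory.Balaban1983to89.B13Lemma3TorusSocket (Lemma3Numerics)
open Literature.MathematicalPhysics.QuantumFieldTheory.Balaban1983to89.B13Lemma3WindowNonvacuity (aw)
open Literature.MathematicalPhysics.QuantumFieldTheory.Balaban1983to89.B13Lemma3TorusNonvacuity (consts numerics_nonvacuous_pos_consts consts_L)
open Literature.MathematicalPhysics.QuantumFieldTheory.Balaban1983to89.Node00.W1 (LetterInputs)
open Summit.QuantumFields.YangMills.BalabanUVNodes.N18HLayerW1NumeralsStrict (smallKP_consts_strict)

/-! ## §1 The relative-aperture leaf numerals, strict clause -/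

/-- **R4 §2 WITH THE STRICT [KP86] CLAUSE** — the numeric conjuncts of the re-typed leaf, at every `M`, every window radius `γ > 0` and every relative aperture `0 < cA < c ≤ 1`,
with `c.C3act * c.ε₁ * Real.exp (5 * r₁ + 1) * K₀ 64 8 * 9 * 64 < 1`; witness R4 §2's (`c := consts`, `r₁ := consts.κ`), the clause from N18's `smallKP_consts_strict`.
[cite: Balaban1988RG2Cluster, (2.15) p.15, (2.26) p.17, (2.31) p.18 and Lemma 3 p.20; Balaban1987RG1, §1 p.263] -/
theorem relCentredLeafNumerals_nonvacuous_anyAperture_strict (M : ℕ) {γ cA c : ℝ} (hγ : 0 < γ) (hcA0 : 0 < cA) (hcAc : cA < c) (hc1 : c ≤ 1) :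
    ∃ (li : LetterInputs) (cs : B13.Consts) (L : ℕ) (a a₂ a₂' a₅ a₅' Aabs r₁ E₀ Mv : ℝ) (D : ℕ → Set ℂ),
      (0 < li.C₀ ∧ 0 < li.θ₅ ∧ li.θ₅ < 1 ∧ 0 ≤ li.C₅ ∧ 2 * li.C₅ / (1 - li.θ₅) ≤ li.C₀ ∧ 0 < li.A ∧ li.μ = 1 ∧ 0 < li.r ∧ li.s = (2 : ℝ)⁻¹) ∧
      8 ≤ cs.L ∧ cs.L = L ∧ Lemma3Numerics cs M ((cs.L : ℝ) / 2) a a₂ a₂' a₅' Aabs ∧ 0 ≤ cs.C3act * cs.ε₁ ∧ 0 ≤ r₁ ∧ li.κ ≤ r₁ ∧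
      r₁ + 2 * (64 * Real.log 162) + 2 ≤ (1 - 8 * cs.δ) * ((cs.L : ℝ) / 2) * cs.κ ∧
      cs.C3act * cs.ε₁ * Real.exp (5 * r₁ + 1) * K₀ 64 8 * 9 * 64 < 1 ∧
      Real.exp 1 * 9 * 64 * K₀ 64 8 ^ 2 * (cs.C3act * cs.ε₁) ≤ E₀ ∧
      (∀ {d n : ℕ} [NeZero n] (Z : TDom d n), 2 * Real.exp (a₅ * ((Z.1).card : ℝ)) ≤ Real.exp (a₅' * ((Z.1).card : ℝ))) ∧
      (∀ i, IsOpen (D i)) ∧ (∀ (i : ℕ), ∀ t ∈ Ioc (0 : ℝ) γ, ((t : ℝ) : ℂ) ∈ D i) ∧ (∀ (i : ℕ), ∀ t ∈ Ioc (0 : ℝ) γ, closedBall (t : ℂ) (cA * t) ⊆ D i) ∧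
      0 < cA ∧ cA < 1 ∧ 0 < Mv ∧ Mv * ((1 + cA) * γ) ^ 2 ≤ 1 / 2 ∧ 2 * Mv * E₀ * (1 + cA) ^ 2 ≤ li.A ∧ li.r ≤ min cA 1 := by
  obtain ⟨hL, -, hC3pos, hκ, hκr, hlarge, -, hrenew⟩ := stripNumerics_consts
  have hsmall := smallKP_consts_strict
  have hE₀ : consts.E₀ = 2 := rfl
  have hγ2 : 0 < γ ^ 2 := by positivity
  have hcA1 : cA < 1 := lt_of_lt_of_le hcAc hc1
  have h1cA : 0 < (1 + cA) * γ := by positivity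
  refine ⟨⟨consts.κ, 1 / 2, 0, 0, 0, 1, 2 / γ ^ 2, 1, cA, (2 : ℝ)⁻¹⟩, consts, consts.L, aw + 40 * (M : ℝ), 1, 1, 1 / 2 - Real.log 2, 1 / 2, 1, consts.κ, 2,
    1 / (2 * ((1 + cA) * γ) ^ 2), fun _ => {z : ℂ | ∃ t ∈ Ioc (0 : ℝ) γ, dist z (t : ℂ) < c * t}, ?_, hL, rfl, lemma3Numerics_consts_anyM M, hC3pos, hκ, hκr, hlarge,
    hsmall, by rw [← hE₀]; exact hrenew, fun Z => ?_, ?_⟩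
  · exact ⟨by norm_num, by norm_num, by norm_num, le_rfl, by norm_num, by positivity, rfl, hcA0, rfl⟩
  · have h := two_mul_exp_le_exp_add_log_two (1 / 2 - Real.log 2) Z
    rwa [sub_add_cancel] at h
  · obtain ⟨ho, hw, hd⟩ := relSector_domainClauses (γ := γ) hcA0 hcAc
    refine ⟨ho, hw, hd, hcA0, hcA1, by positivity, ?_, ?_, le_min le_rfl hcA1.le⟩
    · have : 1 / (2 * ((1 + cA) * γ) ^ 2) * ((1 + cA) * γ) ^ 2 = 1 / 2 := by field_simp
      rw [this]
    · show 2 * (1 / (2 * ((1 + cA) * γ) ^ 2)) * 2 * (1 + cA) ^ 2 ≤ 2 / γ ^ 2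
      have : 2 * (1 / (2 * ((1 + cA) * γ) ^ 2)) * 2 * (1 + cA) ^ 2 = 2 / γ ^ 2 := by field_simp
      rw [this]


/-! ## §2 The window-dilated leaf numerals, strict clause -/

/-- **★ R4 §3 WITH THE STRICT [KP86] CLAUSE** — the numeric conjuncts of the WINDOW-DILATED leaf (the ᴬ ∕ LG storeys' display: letter signs, socket numerals at `a₅′` with the
slack, S25, renewal, STRICT smallness, apertures `0 < cA < cP < 1`, `cP∕(1−cP) < ρb < 1`, `0 < Mv`, `(1−cP)⁻²·Mv·((1+cA)γ)² ≤ ½`, the letter relation and `li.r ≤ min(cA,1)`) are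
jointly satisfiable at every `M`, `γ > 0`, `0 < cA < cP < ½`; R4 §3's rescaling on top of §2-strict. [cite: Balaban1988RG2Cluster, (2.24)-(2.26) p.17, Lemma 3 p.20 and (2.39)-(2.41) p.21; Balaban1987RG1, (2.9)-(2.10) pp.266-267] -/
theorem windowDilatedLeafNumerals_nonvacuous_strict (M : ℕ) {γ cA cP : ℝ} (hγ : 0 < γ) (hcA0 : 0 < cA) (hcAP : cA < cP) (hcP : cP < 1 / 2) :
    ∃ (li : LetterInputs) (cs : B13.Consts) (L : ℕ) (a a₂ a₂' a₅ a₅' Aabs r₁ E₀ Mv ρb : ℝ),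
      (0 < li.C₀ ∧ 0 < li.θ₅ ∧ li.θ₅ < 1 ∧ 0 ≤ li.C₅ ∧ 2 * li.C₅ / (1 - li.θ₅) ≤ li.C₀ ∧ 0 < li.A ∧ li.μ = 1 ∧ 0 < li.r ∧ li.s = (2 : ℝ)⁻¹) ∧
      8 ≤ cs.L ∧ cs.L = L ∧ Lemma3Numerics cs M ((cs.L : ℝ) / 2) a a₂ a₂' a₅' Aabs ∧ 0 ≤ cs.C3act * cs.ε₁ ∧ 0 ≤ r₁ ∧ li.κ ≤ r₁ ∧
      r₁ + 2 * (64 * Real.log 162) + 2 ≤ (1 - 8 * cs.δ) * ((cs.L : ℝ) / 2) * cs.κ ∧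
      cs.C3act * cs.ε₁ * Real.exp (5 * r₁ + 1) * K₀ 64 8 * 9 * 64 < 1 ∧
      Real.exp 1 * 9 * 64 * K₀ 64 8 ^ 2 * (cs.C3act * cs.ε₁) ≤ E₀ ∧
      (∀ {d n : ℕ} [NeZero n] (Z : TDom d n), 2 * Real.exp (a₅ * ((Z.1).card : ℝ)) ≤ Real.exp (a₅' * ((Z.1).card : ℝ))) ∧
      0 < cA ∧ cA < cP ∧ cP < 1 ∧ cP / (1 - cP) < ρb ∧ ρb < 1 ∧ 0 < Mv ∧ (1 - cP)⁻¹ ^ 2 * Mv * ((1 + cA) * γ) ^ 2 ≤ 1 / 2 ∧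
      2 * ((1 - cP)⁻¹ ^ 2 * Mv) * E₀ * (1 + cA) ^ 2 ≤ li.A ∧ li.r ≤ min cA 1 := by
  have hcP1 : cP < 1 := by linarith
  have h1cP : 0 < 1 - cP := by linarith
  obtain ⟨li, cs, L, a, a₂, a₂', a₅, a₅', Aabs, r₁, E₀, Mv₀, D, hsig, hL, hLc, hN, hA0, hr₁, hκ, hrate, hsmall, hrenew, h2w, -, -, -, -, -, hMv₀, hMvγ, hAM,
    hrc⟩ := relCentredLeafNumerals_nonvacuous_anyAperture_strict M hγ hcA0 hcAP hcP1.le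
  have hq : cP / (1 - cP) < 1 := by rw [div_lt_one h1cP]; linarith
  have hresc : (1 - cP)⁻¹ ^ 2 * ((1 - cP) ^ 2 * Mv₀) = Mv₀ := by field_simp
  refine ⟨li, cs, L, a, a₂, a₂', a₅, a₅', Aabs, r₁, E₀, (1 - cP) ^ 2 * Mv₀, (cP / (1 - cP) + 1) / 2, hsig, hL, hLc, hN, hA0, hr₁, hκ, hrate, hsmall, hrenew, h2w,
    hcA0, hcAP, hcP1, by linarith, by linarith, by positivity, ?_, ?_, hrc⟩
  · rw [hresc]; exact hMvγ
  · rw [hresc]; exact hAM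

end YMDAG.N22.W1

end
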